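import Mathlib.Analysis.SpecialFunctions.ImproperIntegrals
import Mathlib.Analysis.SpecialFunctions.Trigonometric.ArctanDeriv
import Mathlib.Analysis.SpecialFunctions.Integrals.Basic
import Mathlib.MeasureTheory.Integral.IntervalIntegral.FundThmCalculus
import Mathlib.Analysis.SpecialFunctions.Complex.LogDeriv
import HarnessLib

/-!
# Integrals over vertical lines: integrability from decay, and `∫ (1/(z-a) - 1/(z-b)) dy`

Topic `Literature/Analysis/Complex`. Elementary toolkit (all PROVED, no named facts) for moving
vertical lines of integration past simple poles with absolutely convergent integrals, as used in
Perron-type formulas with Riesz kernels (`Literature/NumberTheory/LFunctions/MoebiusRieszPerron.lean`,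
`ZetaZeroDetection.lean`):

* `Literature.Analysis.Complex.VLI.integrable_of_continuous_of_norm_le` — a continuous `g : ℝ → E` with
  `‖g y‖ ≤ C (1 + y²)⁻¹` for `|y| ≥ R` is integrable on `ℝ`.
* `Literature.Analysis.Complex.VLI.decay_of_norm_le_div` — the uniform decay hypothesis of the line-shifting lemma
  `Literature.NumberTheory.LFunctions.MertensBoundRH.integral_vertical_eq_of_tendsto` from a bound `‖F(σ+iT)‖ ≤ C/|T|`.
* `Literature.Analysis.Complex.VLI.integral_inv_sub_inv` — for `Re a ≠ c`, `Re b ≠ c`,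
  `∫_ℝ (1/(c+iy-a) − 1/(c+iy-b)) dy = 2π (𝟙[Re a < c] − 𝟙[Re b < c])`
  (the residue bookkeeping for a pair of simple poles; each term alone is not integrable).
  Proof: the antiderivative `arctan((y - Im a)/(c - Re a)) − (i/2) log((c - Re a)² + (y - Im a)²)`
  of `1/(c + iy − a)`, the limits `arctan(±∞) = ±π/2`, and
  `log((p² + (R−t)²)/(p² + (R+t)²)) → 0`.

## References

* E. C. Titchmarsh, *The Theory of Functions*, 2nd ed. (1939), §3.1 (residues at simple poles);
  folklore.
-/

noncomputable section

open Complex Filter Topology Set MeasureTheory Real intervalIntegral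

namespace Literature.Analysis.Complex

namespace VLI

/-! ### Integrability on `ℝ` from continuity and decay -/

/-- A continuous function on `ℝ` with `‖g y‖ ≤ C (1+y²)⁻¹` for `|y| ≥ R` is integrable. [folklore] -/
theorem integrable_of_continuous_of_norm_le {E : Type*} [NormedAddCommGroup E] {g : ℝ → E}
    (hg : Continuous g) {C R : ℝ} (h : ∀ y : ℝ, R ≤ |y| → ‖g y‖ ≤ C * (1 + y ^ 2)⁻¹) :
    Integrable g := by
  have hS : MeasurableSet {y : ℝ | R ≤ |y|} :=
    (isClosed_le continuous_const continuous_abs).measurableSet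
  have h1 : IntegrableOn g (Set.Icc (-|R|) |R|) := hg.integrableOn_Icc
  have h2 : IntegrableOn g {y : ℝ | R ≤ |y|} := by
    refine Integrable.mono' ((integrable_inv_one_add_sq.const_mul C).integrableOn)
      hg.aestronglyMeasurable.restrict ?_
    rw [ae_restrict_iff' hS]
    exact Filter.Eventually.of_forall fun y hy ↦ h y hy
  have h3 : IntegrableOn g (Set.Icc (-|R|) |R| ∪ {y : ℝ | R ≤ |y|}) := h1.union h2
  have huniv : (Set.univ : Set ℝ) ⊆ Set.Icc (-|R|) |R| ∪ {y : ℝ | R ≤ |y|} := by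
    intro y _
    by_cases hy : R ≤ |y|
    · exact Or.inr hy
    · left
      rw [not_le] at hy
      have : |y| ≤ |R| := hy.le.trans (le_abs_self R)
      exact ⟨by linarith [neg_abs_le y], (le_abs_self y).trans this⟩
  exact integrableOn_univ.1 (h3.mono_set huniv)

/-- The uniform decay hypothesis of `integral_vertical_eq_of_tendsto` from a `C/|T|` bound: if
`‖F(σ + iT)‖ ≤ C/|T|` for `σ ∈ [a, b]` and `|T| ≥ R`, then for every `ε > 0` there is `T₀` with
`‖F(σ+iT)‖ ≤ ε` for `σ ∈ [a,b]`, `|T| ≥ T₀`. [folklore] -/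
theorem decay_of_norm_le_div {F : ℂ → ℂ} {a b C R : ℝ}
    (h : ∀ σ ∈ Set.Icc a b, ∀ T : ℝ, R ≤ |T| → ‖F (σ + T * I)‖ ≤ C / |T|) :
    ∀ ε : ℝ, 0 < ε → ∃ T₀ : ℝ, ∀ σ ∈ Set.Icc a b, ∀ T : ℝ, T₀ ≤ |T| → ‖F (σ + T * I)‖ ≤ ε := by
  intro ε hε
  refine ⟨max (max R 1) (C / ε), fun σ hσ T hT ↦ ?_⟩
  have hmax : max R 1 ≤ |T| := (le_max_left _ _).trans hT
  have hR : R ≤ |T| := (le_max_left _ _).trans hmax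
  have h1 : 1 ≤ |T| := (le_max_right _ _).trans hmax
  have hCε : C / ε ≤ |T| := (le_max_right _ _).trans hT
  have hT0 : 0 < |T| := by linarith
  calc ‖F (σ + T * I)‖ ≤ C / |T| := h σ hσ T hR
    _ ≤ ε := by
        rw [div_le_iff₀ hT0]
        rw [div_le_iff₀ hε] at hCε
        nlinarith

/-! ### The antiderivative of `1/(c + iy - a)` -/

/-- For real `p ≠ 0` and real `s`: `1/(p + is) = (p - is)/(p² + s²)`. [folklore] -/
theorem one_div_ofReal_add_mul_I {p : ℝ} (hp : p ≠ 0) (s : ℝ) :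
    (1 : ℂ) / ((p : ℂ) + (s : ℂ) * I) = (((p : ℂ) - (s : ℂ) * I)) / ((p ^ 2 + s ^ 2 : ℝ) : ℂ) := by
  have hne : (p : ℂ) + (s : ℂ) * I ≠ 0 := by
    intro h0
    have := congrArg Complex.re h0
    simp at this
    exact hp this
  have hps : (p ^ 2 + s ^ 2 : ℝ) ≠ 0 := by positivity
  have hpsC : ((p ^ 2 + s ^ 2 : ℝ) : ℂ) ≠ 0 := ofReal_ne_zero.2 hps
  rw [div_eq_div_iff hne hpsC, one_mul]
  push_cast
  ring_nf
  rw [I_sq]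
  ring

/-- Notation (local to this file, not a declaration) for the antiderivative
`Φ[p, t](y) = arctan((y-t)/p) - (i/2) log(p² + (y-t)²)` of `1/(p + i(y-t))` (`p ≠ 0`). -/
local notation "Φ[" p ", " t "]" =>
  (fun y : ℝ ↦ ((Real.arctan ((y - t) / p) : ℝ) : ℂ) - ((Real.log (p ^ 2 + (y - t) ^ 2) / 2 : ℝ) : ℂ) * I)

/-- `Φ' = 1/(p + i(y - t))`. [folklore] -/
theorem hasDerivAt_antider {p : ℝ} (hp : p ≠ 0) (t y : ℝ) :
    HasDerivAt (Φ[p, t]) ((1 : ℂ) / ((p : ℂ) + ((y - t : ℝ) : ℂ) * I)) y := by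
  have hq : 0 < p ^ 2 + (y - t) ^ 2 := by positivity
  -- real derivatives
  have h1 : HasDerivAt (fun y : ℝ ↦ Real.arctan ((y - t) / p)) (p / (p ^ 2 + (y - t) ^ 2)) y := by
    have h := (((hasDerivAt_id' y).sub_const t).div_const p).arctan
    refine h.congr_deriv ?_
    field_simp
  have h2 : HasDerivAt (fun y : ℝ ↦ Real.log (p ^ 2 + (y - t) ^ 2) / 2)
      ((y - t) / (p ^ 2 + (y - t) ^ 2)) y := by
    have h : HasDerivAt (fun y : ℝ ↦ p ^ 2 + (y - t) ^ 2) (2 * (y - t)) y := by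
      have := (((hasDerivAt_id' y).sub_const t).pow 2).const_add (p ^ 2)
      refine this.congr_deriv ?_
      norm_num
    have hl := (h.log hq.ne').div_const 2
    refine hl.congr_deriv ?_
    ring
  have h3 := (h1.ofReal_comp).sub ((h2.ofReal_comp).mul_const I)
  have e : (((p / (p ^ 2 + (y - t) ^ 2) : ℝ) : ℂ)) - (((y - t) / (p ^ 2 + (y - t) ^ 2) : ℝ) : ℂ) * I =
      (1 : ℂ) / ((p : ℂ) + ((y - t : ℝ) : ℂ) * I) := by
    rw [one_div_ofReal_add_mul_I hp]
    push_cast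
    field_simp
  rw [← e]
  exact h3

/-- `c + iy - a = (c - Re a) + i (y - Im a)`. [folklore] -/
theorem ofReal_add_mul_I_sub (c y : ℝ) (a : ℂ) :
    (c : ℂ) + y * I - a = ((c - a.re : ℝ) : ℂ) + ((y - a.im : ℝ) : ℂ) * I := by
  apply Complex.ext <;> simp

/-- On `[-R, R]`: `∫ 1/(c+iy-a) dy = Φ(R) - Φ(-R)` with `p = c - Re a`, `t = Im a`. [folklore] -/
theorem integral_inv_eq_antider_sub {c : ℝ} {a : ℂ} (ha : a.re ≠ c) (R₁ R₂ : ℝ) :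
    ∫ y in R₁..R₂, (1 : ℂ) / ((c : ℂ) + y * I - a) =
      (Φ[c - a.re, a.im]) R₂ - (Φ[c - a.re, a.im]) R₁ := by
  have hp : c - a.re ≠ 0 := sub_ne_zero.2 (Ne.symm ha)
  have hderiv : ∀ y : ℝ, HasDerivAt (Φ[c - a.re, a.im])
      ((1 : ℂ) / ((c : ℂ) + y * I - a)) y := by
    intro y
    rw [ofReal_add_mul_I_sub]
    exact hasDerivAt_antider hp a.im y
  have hcont : Continuous fun y : ℝ ↦ (1 : ℂ) / ((c : ℂ) + y * I - a) := by
    refine Continuous.div continuous_const (by fun_prop) fun y h0 ↦ ?_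
    have := congrArg Complex.re h0
    simp at this
    exact hp (by linarith)
  exact integral_eq_sub_of_hasDerivAt (fun y _ ↦ hderiv y) (hcont.intervalIntegrable _ _)

/-! ### Limits of the antiderivative -/

/-- `arctan((R - t)/p) - arctan((-R - t)/p) → π` (`p > 0`) resp. `→ -π` (`p < 0`) as `R → ∞`.
[folklore] -/
theorem tendsto_arctan_sub_arctan {p : ℝ} (hp : p ≠ 0) (t : ℝ) :
    Tendsto (fun R : ℝ ↦ Real.arctan ((R - t) / p) - Real.arctan ((-R - t) / p)) atTop
      (𝓝 (if 0 < p then π else -π)) := by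
  have hup : Tendsto (fun R : ℝ ↦ R - t) atTop atTop := tendsto_atTop_add_const_right _ _ tendsto_id
  have hdown : Tendsto (fun R : ℝ ↦ -R - t) atTop atBot := by
    have : Tendsto (fun R : ℝ ↦ -R) atTop atBot := tendsto_neg_atTop_atBot
    exact tendsto_atBot_add_const_right _ _ this
  have hT := Real.tendsto_arctan_atTop.mono_right nhdsWithin_le_nhds
  have hB := Real.tendsto_arctan_atBot.mono_right nhdsWithin_le_nhds
  simp only [div_eq_mul_inv]
  rcases lt_or_gt_of_ne hp with hneg | hpos
  · rw [if_neg (not_lt.2 hneg.le)]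
    have hinv : p⁻¹ < 0 := inv_lt_zero.2 hneg
    have h1 : Tendsto (fun R : ℝ ↦ Real.arctan ((R - t) * p⁻¹)) atTop (𝓝 (-(π / 2))) :=
      hB.comp (hup.atTop_mul_const_of_neg hinv)
    have h2 : Tendsto (fun R : ℝ ↦ Real.arctan ((-R - t) * p⁻¹)) atTop (𝓝 (π / 2)) :=
      hT.comp (hdown.atBot_mul_const_of_neg hinv)
    have := h1.sub h2
    convert this using 2
    ring
  · rw [if_pos hpos]
    have hinv : 0 < p⁻¹ := inv_pos.2 hpos
    have h1 : Tendsto (fun R : ℝ ↦ Real.arctan ((R - t) * p⁻¹)) atTop (𝓝 (π / 2)) :=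
      hT.comp (hup.atTop_mul_const hinv)
    have h2 : Tendsto (fun R : ℝ ↦ Real.arctan ((-R - t) * p⁻¹)) atTop (𝓝 (-(π / 2))) :=
      hB.comp (hdown.atBot_mul_const hinv)
    have := h1.sub h2
    convert this using 2
    ring

/-- `log(p² + (R-t)²) - log(p² + (-R-t)²) → 0` as `R → ∞`. [folklore] -/
theorem tendsto_log_sub_log (p t : ℝ) :
    Tendsto (fun R : ℝ ↦ Real.log (p ^ 2 + (R - t) ^ 2) - Real.log (p ^ 2 + (-R - t) ^ 2)) atTop
      (𝓝 0) := by
  -- for `R ≥ 2|t| + 1` both arguments lie in `[p² + (R-|t|)², p² + (R+|t|)²]`, whose log-length is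
  -- `≤ 4R|t|/(p² + (R-|t|)²) ≤ 16|t|/R`.
  have key : ∀ R : ℝ, 2 * |t| + 1 ≤ R →
      |Real.log (p ^ 2 + (R - t) ^ 2) - Real.log (p ^ 2 + (-R - t) ^ 2)| ≤ 16 * |t| * R⁻¹ := by
    intro R hR
    have ht : 0 ≤ |t| := abs_nonneg t
    have hR0 : 0 < R := by linarith
    have hR1 : R - |t| ≥ R / 2 := by linarith
    set u : ℝ := p ^ 2 + (R - |t|) ^ 2 with hu
    set v : ℝ := p ^ 2 + (R + |t|) ^ 2 with hv
    have hu0 : 0 < u := by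
      have : 0 < R - |t| := by linarith
      rw [hu]; positivity
    have huv : u ≤ v := by rw [hu, hv]; nlinarith
    -- both arguments are in `[u, v]`
    have hx1 : u ≤ p ^ 2 + (R - t) ^ 2 ∧ p ^ 2 + (R - t) ^ 2 ≤ v := by
      rw [hu, hv]
      constructor <;> nlinarith [abs_le.1 (le_refl |t|), le_abs_self t, neg_abs_le t, sq_abs t]
    have hx2 : u ≤ p ^ 2 + (-R - t) ^ 2 ∧ p ^ 2 + (-R - t) ^ 2 ≤ v := by
      rw [hu, hv]
      constructor <;> nlinarith [le_abs_self t, neg_abs_le t, sq_abs t]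
    -- log-length of `[u, v]`
    have hlen : Real.log v - Real.log u ≤ 16 * |t| * R⁻¹ := by
      have h1 : Real.log v - Real.log u = Real.log (v / u) := (Real.log_div (by linarith) hu0.ne').symm
      have h2 : Real.log (v / u) ≤ v / u - 1 := Real.log_le_sub_one_of_pos (by positivity)
      have h3 : v / u - 1 = (v - u) / u := by field_simp
      have h4 : v - u = 4 * R * |t| := by rw [hu, hv]; ring
      have h5 : (v - u) / u ≤ 4 * R * |t| / (R / 2) ^ 2 := by
        rw [h4]
        apply div_le_div_of_nonneg_left (by positivity) (by positivity)
        rw [hu]; nlinarith [sq_nonneg p]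
      have h6 : 4 * R * |t| / (R / 2) ^ 2 = 16 * |t| * R⁻¹ := by
        field_simp
        ring
      linarith
    have hlogmono : ∀ x y : ℝ, u ≤ x → x ≤ y → Real.log x ≤ Real.log y :=
      fun x y hx hxy ↦ Real.log_le_log (hu0.trans_le hx) hxy
    rw [abs_le]
    constructor
    · have := hlogmono _ _ hx1.1 (hx1.2)
      have := hlogmono _ _ le_rfl hx1.1
      have := hlogmono _ _ hx2.1 hx2.2
      linarith
    · have := hlogmono _ _ le_rfl hx2.1
      have := hlogmono _ _ hx1.1 hx1.2
      linarith
  have hlim : Tendsto (fun R : ℝ ↦ 16 * |t| * R⁻¹) atTop (𝓝 0) := by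
    simpa using tendsto_inv_atTop_zero.const_mul (16 * |t|)
  refine squeeze_zero_norm' ?_ hlim
  filter_upwards [eventually_ge_atTop (2 * |t| + 1)] with R hR
  rw [Real.norm_eq_abs]
  exact key R hR

/-- `Φ(R) - Φ(-R) → ±π` (sign of `p`) as `R → ∞`. [folklore] -/
theorem tendsto_antider_sub {p : ℝ} (hp : p ≠ 0) (t : ℝ) :
    Tendsto (fun R : ℝ ↦ (Φ[p, t]) R - (Φ[p, t]) (-R)) atTop
      (𝓝 ((if 0 < p then π else -π : ℝ) : ℂ)) := by
  have h1 := tendsto_arctan_sub_arctan hp t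
  have h2 := tendsto_log_sub_log p t
  have h1' := (Complex.continuous_ofReal.tendsto _).comp h1
  have h2' := (Complex.continuous_ofReal.tendsto _).comp h2
  have h3 := h1'.sub ((h2'.div_const 2).mul_const I)
  simp only [Function.comp_def, ofReal_zero, zero_div, zero_mul, sub_zero] at h3
  refine h3.congr fun R ↦ ?_
  push_cast
  ring

/-! ### The line integral of `1/(z-a) - 1/(z-b)` -/

/-- Integrability of `y ↦ 1/(c+iy-a) - 1/(c+iy-b)` on `ℝ` (`Re a, Re b ≠ c`): the difference is
`(a-b)/((c+iy-a)(c+iy-b)) = O(y⁻²)`. [folklore] -/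
theorem integrable_inv_sub_inv {c : ℝ} {a b : ℂ} (ha : a.re ≠ c) (hb : b.re ≠ c) :
    Integrable fun y : ℝ ↦ (1 : ℂ) / ((c : ℂ) + y * I - a) - 1 / ((c : ℂ) + y * I - b) := by
  have hpa : c - a.re ≠ 0 := sub_ne_zero.2 (Ne.symm ha)
  have hpb : c - b.re ≠ 0 := sub_ne_zero.2 (Ne.symm hb)
  have hne : ∀ (d : ℂ), d.re ≠ c → ∀ y : ℝ, (c : ℂ) + y * I - d ≠ 0 := by
    intro d hd y h0
    have := congrArg Complex.re h0
    simp at this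
    exact hd (by linarith)
  have hcont : Continuous fun y : ℝ ↦ (1 : ℂ) / ((c : ℂ) + y * I - a) - 1 / ((c : ℂ) + y * I - b) := by
    refine Continuous.sub ?_ ?_
    · exact Continuous.div continuous_const (by fun_prop) (hne a ha)
    · exact Continuous.div continuous_const (by fun_prop) (hne b hb)
  -- norm lower bounds: `‖c + iy - d‖ ≥ |y - Im d|`
  have hlow : ∀ (d : ℂ) (y : ℝ), |y - d.im| ≤ ‖(c : ℂ) + y * I - d‖ := by
    intro d y
    have := Complex.abs_im_le_norm ((c : ℂ) + y * I - d)
    simpa using this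
  set R : ℝ := 2 * (|a.im| + |b.im|) + 1 with hR
  refine integrable_of_continuous_of_norm_le hcont (C := 8 * ‖a - b‖) (R := R) fun y hy ↦ ?_
  have hy1 : 1 ≤ |y| := by rw [hR] at hy; linarith [abs_nonneg a.im, abs_nonneg b.im]
  have hya : |y| / 2 ≤ |y - a.im| := by
    have := abs_sub_abs_le_abs_sub y a.im
    rw [hR] at hy; linarith [abs_nonneg b.im]
  have hyb : |y| / 2 ≤ |y - b.im| := by
    have := abs_sub_abs_le_abs_sub y b.im
    rw [hR] at hy; linarith [abs_nonneg a.im]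
  have hza : |y| / 2 ≤ ‖(c : ℂ) + y * I - a‖ := hya.trans (hlow a y)
  have hzb : |y| / 2 ≤ ‖(c : ℂ) + y * I - b‖ := hyb.trans (hlow b y)
  have hy0 : 0 < |y| / 2 := by linarith
  have e : (1 : ℂ) / ((c : ℂ) + y * I - a) - 1 / ((c : ℂ) + y * I - b) =
      (a - b) / (((c : ℂ) + y * I - a) * ((c : ℂ) + y * I - b)) := by
    field_simp [hne a ha y, hne b hb y]
    ring
  rw [e, norm_div, norm_mul]
  have hprod : (|y| / 2) * (|y| / 2) ≤ ‖(c : ℂ) + y * I - a‖ * ‖(c : ℂ) + y * I - b‖ :=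
    mul_le_mul hza hzb hy0.le (norm_nonneg _)
  calc ‖a - b‖ / (‖(c : ℂ) + y * I - a‖ * ‖(c : ℂ) + y * I - b‖)
      ≤ ‖a - b‖ / ((|y| / 2) * (|y| / 2)) :=
        div_le_div_of_nonneg_left (norm_nonneg _) (by positivity) hprod
    _ = 4 * ‖a - b‖ * (y ^ 2)⁻¹ := by rw [← sq_abs y]; field_simp; ring
    _ ≤ 4 * ‖a - b‖ * (2 * (1 + y ^ 2)⁻¹) := by
        apply mul_le_mul_of_nonneg_left _ (by positivity)
        rw [← sq_abs y]
        have h1 : (1 : ℝ) ≤ |y| ^ 2 := by nlinarith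
        rw [show (2 : ℝ) * (1 + |y| ^ 2)⁻¹ = ((1 + |y| ^ 2) / 2)⁻¹ by rw [inv_div]; ring]
        exact inv_anti₀ (by positivity) (by linarith)
    _ = 8 * ‖a - b‖ * (1 + y ^ 2)⁻¹ := by ring

/-- **Residues of a pair of simple poles on a vertical line.** For real `c` and complex `a, b`
with `Re a ≠ c`, `Re b ≠ c`:
`∫_ℝ (1/(c+iy-a) - 1/(c+iy-b)) dy = 2π (𝟙[Re a < c] - 𝟙[Re b < c])`.
(Each term alone is only conditionally convergent, with symmetric value `±π`.) [folklore] -/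
theorem integral_inv_sub_inv {c : ℝ} {a b : ℂ} (ha : a.re ≠ c) (hb : b.re ≠ c) :
    ∫ y : ℝ, ((1 : ℂ) / ((c : ℂ) + y * I - a) - 1 / ((c : ℂ) + y * I - b)) =
      2 * π * ((if a.re < c then 1 else 0) - (if b.re < c then 1 else 0)) := by
  have hpa : c - a.re ≠ 0 := sub_ne_zero.2 (Ne.symm ha)
  have hpb : c - b.re ≠ 0 := sub_ne_zero.2 (Ne.symm hb)
  have hint := integrable_inv_sub_inv ha hb
  -- the symmetric truncations converge to the integral
  have hlim := intervalIntegral_tendsto_integral hint tendsto_neg_atTop_atBot tendsto_id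
  -- and are computed by the antiderivatives
  have hcont : ∀ (d : ℂ), d.re ≠ c → Continuous fun y : ℝ ↦ (1 : ℂ) / ((c : ℂ) + y * I - d) := by
    intro d hd
    refine Continuous.div continuous_const (by fun_prop) fun y h0 ↦ ?_
    have := congrArg Complex.re h0
    simp at this
    exact hd (by linarith)
  have htrunc : ∀ R : ℝ, ∫ y in (-R)..R, ((1 : ℂ) / ((c : ℂ) + y * I - a) - 1 / ((c : ℂ) + y * I - b)) =
      ((Φ[c - a.re, a.im]) R - (Φ[c - a.re, a.im]) (-R)) -
        ((Φ[c - b.re, b.im]) R - (Φ[c - b.re, b.im]) (-R)) := by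
    intro R
    rw [intervalIntegral.integral_sub ((hcont a ha).intervalIntegrable _ _)
      ((hcont b hb).intervalIntegrable _ _), integral_inv_eq_antider_sub ha,
      integral_inv_eq_antider_sub hb]
  have hlim2 : Tendsto (fun R : ℝ ↦ ∫ y in (-R)..R,
      ((1 : ℂ) / ((c : ℂ) + y * I - a) - 1 / ((c : ℂ) + y * I - b))) atTop
      (𝓝 (((if 0 < c - a.re then π else -π : ℝ) : ℂ) - ((if 0 < c - b.re then π else -π : ℝ) : ℂ))) := by
    simp_rw [htrunc]
    exact (tendsto_antider_sub hpa a.im).sub (tendsto_antider_sub hpb b.im)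
  have heq := tendsto_nhds_unique (hlim.congr fun R ↦ by simp) hlim2
  rw [heq]
  have e1 : (0 < c - a.re) = (a.re < c) := by rw [sub_pos]
  have e2 : (0 < c - b.re) = (b.re < c) := by rw [sub_pos]
  simp only [e1, e2]
  by_cases h1 : a.re < c
  · by_cases h2 : b.re < c
    · simp only [if_pos h1, if_pos h2]; ring
    · simp only [if_pos h1, if_neg h2]; push_cast; ring
  · by_cases h2 : b.re < c
    · simp only [if_neg h1, if_pos h2]; push_cast; ring
    · simp only [if_neg h1, if_neg h2]; ring

end VLI

end Literature.Analysis.Complex
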